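import Literature.Barriers.CriticalPhenomena.GridSAWCountingSharpPComplete
import Literature.Computability.Complexity.FPStringBricks
import Literature.Computability.Complexity.FoldBricks
import Literature.Computability.Complexity.PlumbingBricks
import HarnessLib

/-!
# Barrier (CriticalPhenomena / SAWScalingLimit): discharge of
# `GridSAW.sharpP_subset_FP_of_hasPolyTimeSAWCount`

Sibling proof file of `GridSAWCountingSharpPComplete.lean` (Liśkiewicz–Ogihara–Toda 2003,
Theorem 7): the consequence of the barrier for the technique class, recorded there as the named
statement `GridSAW.sharpP_subset_FP_of_hasPolyTimeSAWCount`

  `GridSAWCountingSharpPComplete → HasPolyTimeSAWCount → ∀ f ∈ #P, (encodeNat ∘ f) ∈ FP`,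

is PROVED here (`GridSAW.sharpP_subset_FP_of_hasPolyTimeSAWCount_holds`). It is kept in a
separate module so that the machine toolkit used by the proof (`FPStringBricks`,
`PlumbingBricks`) stays out of the import closure of the barrier file.

## The printed argument

[cite: LiskiewiczOgiharaToda2003, §2.2]: "`f` is polynomial-time right-bit-shift reducible to
`g` … if there is a polynomial-time computable function `R₃ : Σ* → ℕ − {0}` such that … for all
`x`, `f(x) = g(R₁(x)) div 2^{R₃(x)}`, where div is integer division" — a special case of a
polynomial-time one-Turing reduction `f(x) = R₂(x, g(R₁(x)))` with `R₁`, `R₂` polynomial-time.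
Hence if `g` is computable in polynomial time, so is every `f ≤ᵖ_{r-shift} g`: compose `R₁`, the
procedure for `g`, and the shift. With `g = SAWCOUNT₄` complete for `#P` (Theorem 7 (4), the
hypothesis `GridSAWCountingSharpPComplete`) this gives `#P ⊆ FP` — the form of
[cite: AroraBarakCC2009, Prop. 17.9] ("If `f` is `#P`-complete and `f ∈ FP`, then `FP = #P`").

## What is formalised

Over the tree's string class `Literature.Computability.Complexity.FP` and Mathlib's little-endian numerals
`Computability.encodeNat` (`⌜0⌝ = []`, least significant bit first, last bit `true`):

* `GridSAW.isCanonicalNum_drop`, `GridSAW.encodeNat_div_two_pow`: **right shift is `List.drop`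
  on numerals**, `⌜n div 2^k⌝ = (⌜n⌝).drop k` (the value identity `⟦w.drop k⟧ = ⟦w⟧ div 2^k` is
  the toolkit's `Literature.Computability.Complexity.Brick.bitsToNat_drop`, `FoldBricks.lean`,
  imported here; this leaf file formerly carried a local twin of it);
* `GridSAW.divTwoPow_mem_FP`: for `⌜a⌝, ⌜b⌝ ∈ FP` the shifted function
  `x ↦ ⌜a x div 2^{b x}⌝` is in `FP`. The shift amount `b x` is given in BINARY and may exceed
  `|⌜a x⌝|`, so it is first converted to the unary numeral `1^{min (b x) |⌜a x⌝|}` capped by the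
  ruler `⌜a x⌝` (`Literature.Computability.Complexity.binToUnaryFn`, `FPStringBricks.lean`), then
  `Literature.Computability.Complexity.Plumb.dropFn ⟨u, z⟩ = z.drop |u|` (`PlumbingBricks.lean`)
  drops that many bits — an assembly of existing bricks by `comp_mem_FP`/`fanoutFn_mem_FP`, no
  new machine;
* `GridSAW.RShiftReducible.encodeNat_comp_mem_FP`: **`FP`-computability of numerals descends
  along `≤ᵖ_{r-shift}`-reductions** (`f ≤ᵖ_{r-shift} g`, `⌜g⌝ ∈ FP ⟹ ⌜f⌝ ∈ FP`: compose `R₁`,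
  the procedure for `g`, and the shift — the printed remark that `≤ᵖ_{r-shift}` is a case of
  `≤ᵖ_{1-T}`), the one lemma behind everything below;
* `GridSAW.sharpP_subset_FP_of_hasPolyTimeSAWCount_holds`: the discharge; and its fixed-length
  analogue `GridSAW.sharpP_subset_FP_of_hasPolyTimeSAWCountFixedLength`, proved outright (so not
  recorded as a named statement in the barrier file).
* `GridSAW.IsSharpPCompleteRShift.encodeNat_mem_FP_iff` and the corollaries
  `GridSAW.hasPolyTimeSAWCount_iff_sharpP_subset_FP`,
  `GridSAW.hasPolyTimeSAWCountFixedLength_iff_sharpP_subset_FP`,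
  `GridSAW.hasPolyTimeSAWCount_iff_fixedLength`: a `≤ᵖ_{r-shift}`-complete counting function has
  polynomial-time numerals iff `#P ⊆ FP` (Arora–Barak, Prop. 17.9, for the source's notion of
  completeness), so under the barrier BOTH technique classes `HasPolyTimeSAWCount`,
  `HasPolyTimeSAWCountFixedLength` are equivalent to `#P ⊆ FP` and to each other — they are
  hypotheses (the class of methods the barrier excludes), not results of any source, and in
  particular not of Barahona 1982, whose polynomial-time Pfaffian evaluation concerns the planar
  ISING partition function (§1, §3.2) and is quoted in the barrier file only as a contrast.
* `GridSAW.not_hasPolyTimeSAWCountFixedLength_of`, `GridSAW.not_hasPolyTimeSAWCount_of`: the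
  no-go reading — if some `#P` function has no polynomial-time numerals (`FP ≠ #P`, string form)
  then, under Theorem 7 (1), resp. (4) alone (`LOT2003_thm7_fixedLength`, `LOT2003_thm7_anyLength`),
  the corresponding technique class is EMPTY; neither class has a discharge short of `FP = #P`.
-/

noncomputable section

namespace Literature.Barriers.CriticalPhenomena

open _root_.Computability Literature.Computability.Complexity

namespace GridSAW

/-! ### Right shift on little-endian numerals is `List.drop`

The value identity `⟦w.drop k⟧ = ⟦w⟧ div 2^k` is the toolkit's `Brick.bitsToNat_drop`
(`FoldBricks.lean`); here it is lifted to Mathlib's canonical numerals `encodeNat`. -/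

/-- A suffix `w.drop k` of a canonical numeral `w` (empty or ending in `true`) is canonical.
[folklore] -/
theorem isCanonicalNum_drop {w : List Bool} (hw : IsCanonicalNum w) (k : ℕ) :
    IsCanonicalNum (w.drop k) := by
  by_cases hk : w.length ≤ k
  · exact Or.inl (List.drop_eq_nil_of_le hk)
  · rcases hw with rfl | h
    · exact Or.inl (by simp)
    · refine Or.inr ?_
      rw [List.getLast?_drop, if_neg hk, h]

/-- **Right shift is `drop` on Mathlib's numerals**: `⌜n div 2^k⌝ = (⌜n⌝).drop k`
(`⌜·⌝ = Computability.encodeNat`, least significant bit first; for `2^k > n` both sides are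
`[] = ⌜0⌝`; values by `Brick.bitsToNat_drop`, canonicity by `isCanonicalNum_drop`). [cite: LiskiewiczOgiharaToda2003, §1 ("right-bitshifting the count in its binary representation, i.e., truncating the binary representation at the right end")] -/
theorem encodeNat_div_two_pow (n k : ℕ) : encodeNat (n / 2 ^ k) = (encodeNat n).drop k := by
  obtain ⟨m, hm⟩ := (isCanonicalNum_iff _).1 (isCanonicalNum_drop (isCanonicalNum_encodeNat n) k)
  have hmv : m = n / 2 ^ k := by
    have h := congrArg bitsToNat hm
    rwa [bitsToNat_encodeNat, Brick.bitsToNat_drop, bitsToNat_encodeNat] at h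
  rw [← hmv, hm]

/-! ### The right-shift map `x ↦ ⌜a x div 2^{b x}⌝ is in `FP` -/

/-- **Binary right shift is polynomial time**: if `x ↦ ⌜a x⌝` and `x ↦ ⌜b x⌝` are in `FP` then so
is `x ↦ ⌜a x div 2^{b x}⌝` — the post-computation `R₂(x, y) = y div 2^{R₃(x)}` of a
`≤ᵖ_{r-shift}`-reduction. The map is realised as
`dropFn ⟨binToUnaryFn ⟨⌜a x⌝, ⌜b x⌝⟩, ⌜a x⌝⟩ = (⌜a x⌝).drop (min (b x) |⌜a x⌝|)`: the shift amount
arrives in BINARY and may exceed `|⌜a x⌝|`, so it is converted to unary only up to the length of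
the ruler `⌜a x⌝` (`Literature.Computability.Complexity.binToUnaryFn`, a clocked loop of `|⌜a x⌝|` rounds,
`FPStringBricks.lean`), after which
`Literature.Computability.Complexity.Plumb.dropFn ⟨u, z⟩ = z.drop |u|` (`PlumbingBricks.lean`)
drops that many low-order bits; an assembly of existing bricks by `comp_mem_FP`/`fanoutFn_mem_FP`,
no new machine.
[cite: LiskiewiczOgiharaToda2003, §2.2 (R₂(x, y) = y div 2^{R₃(x)})] [cite: AroraBarakCC2009, §1.3 and Thm. 2.8 (proof: closure under composition)] -/
theorem divTwoPow_mem_FP {a b : List Bool → ℕ} (ha : (encodeNat ∘ a) ∈ FP)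
    (hb : (encodeNat ∘ b) ∈ FP) : (encodeNat ∘ fun x => a x / 2 ^ b x) ∈ FP := by
  have h : (encodeNat ∘ fun x => a x / 2 ^ b x) =
      Plumb.dropFn ∘ fanoutFn (binToUnaryFn ∘ fanoutFn (encodeNat ∘ a) (encodeNat ∘ b))
        (encodeNat ∘ a) := by
    funext x
    simp only [Function.comp_apply, fanoutFn_apply, Plumb.dropFn_boolPair,
      binToUnaryFn_boolPair, bitsToNat_encodeNat, List.length_replicate]
    rw [← List.drop_eq_drop_min, encodeNat_div_two_pow]
  rw [h]
  exact comp_mem_FP Plumb.dropFn_mem_FP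
    (fanoutFn_mem_FP (comp_mem_FP binToUnaryFn_mem_FP (fanoutFn_mem_FP ha hb)) ha)

/-! ### `FP`-computability of numerals descends along `≤ᵖ_{r-shift}`-reductions -/

/-- **If `f ≤ᵖ_{r-shift} g` and `⌜g⌝ ∈ FP` then `⌜f⌝ ∈ FP`** (`⌜·⌝ = encodeNat ∘ ·`, the binary
value as a string function): compose the instance map `R₁` with the procedure for `g`
(`comp_mem_FP`) and shift right by `R₃(x)` bits (`divTwoPow_mem_FP`),
`⌜f(x)⌝ = ⌜g(R₁(x)) div 2^{R₃(x)}⌝`. This is the content of the printed remark that a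
`≤ᵖ_{r-shift}`-reduction is the special case `R₂(x, y) = y div 2^{R₃(x)}` of a polynomial-time
one-Turing reduction `f(x) = R₂(x, g(R₁(x)))` with `R₁`, `R₂` polynomial-time.
[cite: LiskiewiczOgiharaToda2003, §2.2 (≤ᵖ_{r-shift} as a case of ≤ᵖ_{1-T})] -/
theorem RShiftReducible.encodeNat_comp_mem_FP {f g : List Bool → ℕ} (hfg : RShiftReducible f g)
    (hg : (encodeNat ∘ g) ∈ FP) : (encodeNat ∘ f) ∈ FP := by
  obtain ⟨R₁, hR₁, R₃, hR₃, -, hred⟩ := hfg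
  have hA : (encodeNat ∘ fun x => g (R₁ x)) ∈ FP := comp_mem_FP hg hR₁
  have hf_eq : (encodeNat ∘ f) = (encodeNat ∘ fun x => g (R₁ x) / 2 ^ R₃ x) := by
    funext x
    simp only [Function.comp_apply, hred x]
  rw [hf_eq]
  exact divTwoPow_mem_FP hA hR₃

/-! ### The discharge -/

/-- **Discharge of `sharpP_subset_FP_of_hasPolyTimeSAWCount`** (D-0014: the fact stays a `def`;
users' `(h : sharpP_subset_FP_of_hasPolyTimeSAWCount)` are fed this theorem): under the barrier
`GridSAWCountingSharpPComplete` (Theorem 7, versions (1) and (4)), a polynomial-time exact count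
of SAWs (`HasPolyTimeSAWCount : ⌜SAWCOUNT₄⌝ ∈ FP`) puts every `#P` function in `FP`. Proof as
printed in §2.2: for `f ∈ #P` take the `≤ᵖ_{r-shift}`-reduction `(R₁, R₃)` to `SAWCOUNT₄`
(`hbar.2.2 f hf`), so `f(x) = SAWCOUNT₄(R₁(x)) div 2^{R₃(x)}`; `⌜SAWCOUNT₄ ∘ R₁⌝ ∈ FP` by
composition (`comp_mem_FP`) and the shift by `R₃(x)` bits is `divTwoPow_mem_FP` (the two steps
are packaged as `RShiftReducible.encodeNat_comp_mem_FP`).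
[cite: LiskiewiczOgiharaToda2003, Theorem 7 and §2.2] [cite: AroraBarakCC2009, Prop. 17.9] -/
theorem sharpP_subset_FP_of_hasPolyTimeSAWCount_holds :
    sharpP_subset_FP_of_hasPolyTimeSAWCount :=
  fun hbar hcount f hf => (hbar.2.2 f hf).encodeNat_comp_mem_FP hcount

/-! ### Under the barrier the technique classes are equivalent to `#P ⊆ FP` -/

/-- **A `≤ᵖ_{r-shift}`-complete counting function has polynomial-time numerals iff `#P ⊆ FP`**
(numerals `⌜f x⌝` of every `#P` function computable in `FP`): `→` composes, for `f ∈ #P`, the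
reduction `R₁`, the procedure for `g` and the shift by `R₃(x)` bits (`divTwoPow_mem_FP`), exactly
as in `sharpP_subset_FP_of_hasPolyTimeSAWCount_holds` (`RShiftReducible.encodeNat_comp_mem_FP`);
`←` is the membership half `g ∈ #P` of completeness. This is "If `f` is `#P`-complete and
`f ∈ FP`, then `FP = #P`" for the source's `≤ᵖ_{r-shift}` notion of completeness (a one-query
special case of the oracle notion of Arora–Barak, Def. 17.8).
[cite: AroraBarakCC2009, Prop. 17.9] [cite: LiskiewiczOgiharaToda2003, §2.2] -/
theorem IsSharpPCompleteRShift.encodeNat_mem_FP_iff {g : List Bool → ℕ}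
    (hg : IsSharpPCompleteRShift g) :
    (encodeNat ∘ g) ∈ FP ↔ ∀ f ∈ SharpP, (encodeNat ∘ f) ∈ FP :=
  ⟨fun hcount f hf => (hg.2 f hf).encodeNat_comp_mem_FP hcount, fun h => h g hg.1⟩

/-- **Under the barrier, `HasPolyTimeSAWCount ↔ #P ⊆ FP`** (Theorem 7, version (4), with
Prop. 17.9 of Arora–Barak): the technique class of `GridSAWCountingSharpPComplete` is a
HYPOTHESIS with the truth value of `FP = #P`. It is not a statement of any source — discharging
it would be a polynomial-time algorithm for a `#P`-complete function, refuting it a proof of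
`#P ⊄ FP` — and the planar Ising partition function mentioned in its docstring (Barahona 1982,
§1 and §3.2: "for any planar lattice, the partition function can be computed … in polynomial time
by computing an appropriate Pfaffian") is a contrast, not a source for it.
[cite: LiskiewiczOgiharaToda2003, Theorem 7 (version (4)) and §2.2] [cite: AroraBarakCC2009, Prop. 17.9] -/
theorem hasPolyTimeSAWCount_iff_sharpP_subset_FP (hbar : GridSAWCountingSharpPComplete) :
    HasPolyTimeSAWCount ↔ ∀ f ∈ SharpP, (encodeNat ∘ f) ∈ FP :=
  hbar.2.encodeNat_mem_FP_iff

/-- **Under the barrier, `HasPolyTimeSAWCountFixedLength ↔ #P ⊆ FP`** (Theorem 7, version (1)):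
the fixed-length technique class is likewise a hypothesis with the truth value of `FP = #P`.
[cite: LiskiewiczOgiharaToda2003, Theorem 7 (version (1)) and §2.2] [cite: AroraBarakCC2009, Prop. 17.9] -/
theorem hasPolyTimeSAWCountFixedLength_iff_sharpP_subset_FP
    (hbar : GridSAWCountingSharpPComplete) :
    HasPolyTimeSAWCountFixedLength ↔ ∀ f ∈ SharpP, (encodeNat ∘ f) ∈ FP :=
  hbar.1.encodeNat_mem_FP_iff

/-- Under the barrier the two technique classes (any length / fixed length) are equivalent to
each other. [cite: LiskiewiczOgiharaToda2003, Theorem 7 (versions (1) and (4))] -/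
theorem hasPolyTimeSAWCount_iff_fixedLength (hbar : GridSAWCountingSharpPComplete) :
    HasPolyTimeSAWCount ↔ HasPolyTimeSAWCountFixedLength :=
  (hasPolyTimeSAWCount_iff_sharpP_subset_FP hbar).trans
    (hasPolyTimeSAWCountFixedLength_iff_sharpP_subset_FP hbar).symm

/-- **Fixed-length analogue of `sharpP_subset_FP_of_hasPolyTimeSAWCount`** (proved outright,
hence not recorded as a named statement in the barrier file): under the barrier
`GridSAWCountingSharpPComplete` (Theorem 7 (1) ∧ (4)), a polynomial-time exact evaluation of the
fixed-length two-point counts `c_n(E; 0, t)` of arbitrary finite subgraphs `E` of `ℤ²`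
(`HasPolyTimeSAWCountFixedLength : ⌜SAWCOUNT₁⌝ ∈ FP`) puts every `#P` function in `FP`; only the
first conjunct (version (1)) is used.
[cite: LiskiewiczOgiharaToda2003, Theorem 7 (version (1)) and §2.2] [cite: AroraBarakCC2009, Prop. 17.9] -/
theorem sharpP_subset_FP_of_hasPolyTimeSAWCountFixedLength (hbar : GridSAWCountingSharpPComplete)
    (hcount : HasPolyTimeSAWCountFixedLength) : ∀ f ∈ SharpP, (encodeNat ∘ f) ∈ FP :=
  (hasPolyTimeSAWCountFixedLength_iff_sharpP_subset_FP hbar).1 hcount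

/-! ### The no-go reading: under `FP ≠ #P` both technique classes are empty -/

/-- **No polynomial-time exact fixed-length SAW count unless `FP = #P`**: if some `#P` function
has no polynomial-time numerals (`∃ f ∈ #P, ⌜f⌝ ∉ FP`, the string form of `FP ≠ #P`) then, by
Theorem 7 (1) alone (`LOT2003_thm7_fixedLength`: `SAWCOUNT₁` is complete for `#P` under
`≤ᵖ_{r-shift}`-reductions), there is NO polynomial-time exact evaluation of the fixed-length
two-point SAW counts of arbitrary finite subgraphs of `ℤ²` — the technique class
`HasPolyTimeSAWCountFixedLength` is empty. (So this class, a hypothesis predicate of the barrier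
file, has no discharge short of `FP = #P` and no refutation short of `FP ≠ #P`.)
[cite: LiskiewiczOgiharaToda2003, Theorem 7 (version (1)) and §2.2] [cite: AroraBarakCC2009, Prop. 17.9] -/
theorem not_hasPolyTimeSAWCountFixedLength_of (hsep : ∃ f ∈ SharpP, (encodeNat ∘ f) ∉ FP)
    (h : LOT2003_thm7_fixedLength) : ¬ HasPolyTimeSAWCountFixedLength := by
  intro hcount
  obtain ⟨f, hf, hfFP⟩ := hsep
  exact hfFP ((IsSharpPCompleteRShift.encodeNat_mem_FP_iff h).1 hcount f hf)

/-- **No polynomial-time exact any-length SAW count unless `FP = #P`**: `∃ f ∈ #P, ⌜f⌝ ∉ FP` and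
Theorem 7 (4) alone (`LOT2003_thm7_anyLength`) give `¬ HasPolyTimeSAWCount`.
[cite: LiskiewiczOgiharaToda2003, Theorem 7 (version (4)) and §2.2] [cite: AroraBarakCC2009, Prop. 17.9] -/
theorem not_hasPolyTimeSAWCount_of (hsep : ∃ f ∈ SharpP, (encodeNat ∘ f) ∉ FP)
    (h : LOT2003_thm7_anyLength) : ¬ HasPolyTimeSAWCount := by
  intro hcount
  obtain ⟨f, hf, hfFP⟩ := hsep
  exact hfFP ((IsSharpPCompleteRShift.encodeNat_mem_FP_iff h).1 hcount f hf)

end GridSAW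

end Literature.Barriers.CriticalPhenomena
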